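import Literature.Geometry.Riemannian.L2HarmonicOneFormsSobolev
import Literature.Geometry.Riemannian.EigenvaluePinchingSphereProofs
import Literature.Geometry.Lorentzian.CoordinateFrames
import Literature.Geometry.Lorentzian.MassCapacityHarmonic
import Literature.Geometry.Riemannian.OneFormSobolevInequality
import Literature.Geometry.Lorentzian.GreenIdentityCompactSupport
import Literature.Analysis.Calculus.PoincareLemmaOneForm
import Mathlib.Geometry.Manifold.BumpFunction
import HarnessLib

/-!
# The Bochner formula for harmonic `1`-forms, `Δ|α|² = 2|∇α|² + 2 Ric(♯α, ♯α)`, and the energy estimate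

Second layer of the proof programme of the named fact
`Literature.Geometry.Riemannian.Carron1999_finrank_l2HarmonicOneForms_le` (Carron 1999 =
Carron's habilitation memoir, Thm. 4.3, `k = 1`): the **Bochner–Weitzenböck formula for
`1`-forms** in the pointwise form used in the printed proof (memoir §4.a, `Δ₁ = ∇*∇ + R₁`,
`R₁ = Ric`; Carron 2007, arXiv:0704.3194, proof of Cor. 2.12), for the members of `ℋ¹(X, h)` of
`L2HarmonicOneFormsSobolev.lean` (smooth `1`-forms with `∇α` symmetric and trace-free):

  `Δ_h (h⁻¹(α, α)) (x) = 2 |∇α|²_h (x) + 2 Ric(♯α, ♯α)(x)`   (`dalembertian_innerDual_eq_of_mem_l2HarmonicOneForms`).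

The proof goes through **local exactness**: a closed `1`-form is locally `du`
(`exists_contMDiff_mvfderiv_eq_of_isSymm` — the Poincaré lemma on the manifold, from the chart
computation `covDerivOneForm_localFrame_sub` of `(∇α)(∂ᵢ,∂ⱼ) − (∇α)(∂ⱼ,∂ᵢ)` and the radial
homotopy operator of `Literature/Analysis/Calculus/PoincareLemmaOneForm.lean`, Spivak 1965,
Thm. 4-11, globalised by a bump function), then `∇α = Hess u` (`covDerivOneForm_mvfderiv`),
`Δ_h u = tr ∇α = 0`, and the tree's Bochner formula for functions
`Δ|∇u|² = 2|Hess u|² + 2 h⁻¹(du, dΔu) + 2 Ric(∇u, ∇u)` (`dalembertian_gradSq_eq`,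
`EigenvaluePinchingSphereProofs.lean`, Topping 2006, proof of Prop. 8.2.6) loses its middle term
(`dalembertian_innerDual_eq_of_isSymm_of_trace_eq_zero`, any pseudo-Riemannian metric).

Then the **integrated** form (memoir §4.a, proof of Prop. 4.1: "on peut justifier la formule
d'intégration par partie `0 = ⟨α, Δ_k α⟩ = ∫|∇α|² + ⟨R_k α, α⟩`"; Carron 2007, proof of
Cor. 2.12), localised with a test function `χ ∈ C^∞_c` on a manifold modelled on `ℝ^m` (where the
tree's Green identity `GreenIdentityCompactSupport.lean` is available):

* `contMDiffAt_normSq_covDerivOneForm` — `|∇α|²` is `C^∞` (through the local potential,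
  `contMDiff_normSq_hessian`; `|α|²` is, by `OneFormSobolevInequality.contMDiffAt_innerDual_oneForm`);
* `neg_innerDual_mvfderiv_sq_le` — the pointwise Kato–Cauchy–Schwarz bound
  `-h⁻¹(d(χ²), d|α|²) ≤ χ²|∇α|² + 4|dχ|²|α|²` (`OneFormKatoInequality.kato_sq`);
* `integral_sq_mul_bochner_eq_neg_integral_innerDual` —
  `∫ χ² (2|∇α|² + 2Ric(♯α,♯α)) dμ_h = -∫ h⁻¹(d(χ²), d|α|²) dμ_h` for `α ∈ ℋ¹(N, h)`;
* `integral_sq_mul_normSq_covDerivOneForm_le` — the **energy (Caccioppoli) estimate**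
  `∫ χ²|∇α|² ≤ 4∫|dχ|²|α|² - 2∫χ² Ric(♯α,♯α)`, the form in which, with the cut-offs of a complete
  manifold, `∇α ∈ L²` and `∫|∇α|² + Ric(♯α,♯α) ≤ 0` enter the proof of Thm. 4.3.

Everything is proved; no definitions, no named facts (D-0026). The remaining layers of Carron's
argument (cut-offs from completeness, the space `H¹₀` of forms, compactness, the
Cwikel–Lieb–Rozenblum count) are analytic.

## References

* G. Carron, *Formes harmoniques L² sur les variétés riemanniennes non-compactes*, mémoire
  d'habilitation (1999) = Rend. Mat. Appl. (7) 21 (2001), §4.a (Bochner–Weitzenböck), §4.b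
  Thm. 4.3. [`Carron1999HdR`]
* G. Carron, *L² harmonic forms on non-compact Riemannian manifolds*, arXiv:0704.3194, proof of
  Cor. 2.12 (Bochner identity for `α ∈ ℋ¹`). [`Carron2007`]
* M. Spivak, *Calculus on Manifolds* (1965), Thm. 4-11 (Poincaré Lemma). [`Spivak1965`]
* B. O'Neill, *Semi-Riemannian geometry* (1983), Ch. 3, Def. 3.17 (covariant differential of a
  one-form), Ch. 1, Lemma 1.18 ff. (coordinate vector fields commute). [`ONeill1983`]
* P. Topping, *Lectures on the Ricci flow* (2006), proof of Prop. 8.2.6 (Bochner formula).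
  [`Topping2006`]
* J. M. Lee, *Introduction to Riemannian Manifolds*, 2nd ed. (2018), Problem 2-23 (a) (Green's
  first identity). [`Lee2018`]
-/

noncomputable section

open Bundle Set Function Filter FiberBundle VectorField Metric
open scoped Manifold ContDiff Topology

namespace Literature.Geometry.Riemannian

open Literature.Geometry.Lorentzian Literature.Analysis.Calculus

variable {E : Type*} [NormedAddCommGroup E] [NormedSpace ℝ E] {H : Type*} [TopologicalSpace H]
  {I : ModelWithCorners ℝ E H} {X : Type*} [TopologicalSpace X] [ChartedSpace H X]
  [IsManifold I ∞ X] [FiniteDimensional ℝ E] [CompleteSpace E] [I.Boundaryless]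
  (g : PseudoRiemannianMetric I ∞ E (TangentSpace I : X → Type _)) [g.HasLeviCivita]
  {ι : Type*} (b : Module.Basis ι ℝ E) {x₀ p : X}

/-- **The exterior derivative of a `1`-form in a chart.** For a `1`-form `α` differentiable at a
point `p` of the chart domain of `x₀`, with coordinate frame `∂ᵢ` and chart `φ`:
`(∇α)_p(∂ᵢ, ∂ⱼ) - (∇α)_p(∂ⱼ, ∂ᵢ) = ∂ⱼ α̂ᵢ (φ p) - ∂ᵢ α̂ⱼ (φ p)`, `α̂ₖ = α(∂ₖ) ∘ φ⁻¹` — i.e.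
`(∇_Y α)(Z) - (∇_Z α)(Y) = -dα(Y, Z)` has the classical coordinate expression, the Christoffel
terms cancelling by torsion-freeness (`∇_{∂ᵢ}∂ⱼ = ∇_{∂ⱼ}∂ᵢ`, the coordinate fields commute).
Carron 2007, §1.1.3 (a) (`dα = ∑ θⁱ ∧ ∇_{Eᵢ} α`); O'Neill 1983, Ch. 3, Def. 3.17 and Ch. 1,
Lemma 1.18 ff. [cite: ONeill1983, Ch. 3, Def. 3.17] -/
theorem covDerivOneForm_localFrame_sub (hp : p ∈ (chartAt H x₀).source)
    {α : Π x : X, TangentSpace I x →L[ℝ] ℝ}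
    (hα : MDifferentiableAt I (I.prod 𝓘(ℝ, E →L[ℝ] ℝ)) (oneFormSection α) p) (i j : ι) :
    g.covDerivOneForm α p ((trivializationAt E (TangentSpace I) x₀).localFrame b i p)
        ((trivializationAt E (TangentSpace I) x₀).localFrame b j p) -
      g.covDerivOneForm α p ((trivializationAt E (TangentSpace I) x₀).localFrame b j p)
        ((trivializationAt E (TangentSpace I) x₀).localFrame b i p) =
      fderiv ℝ ((fun q ↦ α q ((trivializationAt E (TangentSpace I) x₀).localFrame b i q)) ∘
          (extChartAt I x₀).symm) (extChartAt I x₀ p) (b j) -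
        fderiv ℝ ((fun q ↦ α q ((trivializationAt E (TangentSpace I) x₀).localFrame b j q)) ∘
          (extChartAt I x₀).symm) (extChartAt I x₀ p) (b i) := by
  set e := trivializationAt E (TangentSpace I) x₀
  have hpe : p ∈ e.baseSet := by simpa [e] using hp
  have hs : ∀ k, MDiffAt (T% (e.localFrame b k)) p := fun k ↦
    (contMDiffAt_localFrame_of_mem 1 e b k hpe).mdifferentiableAt one_ne_zero
  -- torsion-freeness on the commuting coordinate fields
  have htor : g.leviCivita (e.localFrame b i) p (e.localFrame b j p) =
      g.leviCivita (e.localFrame b j) p (e.localFrame b i p) := by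
    have h0 := (PseudoRiemannianMetric.isLeviCivita_leviCivita_holds (g := g)).1
    rw [CovariantDerivative.torsion_eq_zero_iff] at h0
    have h1 := h0 (hs j) (hs i)
    rw [mlieBracket_localFrame_trivializationAt b hp j i] at h1
    exact (sub_eq_zero.1 h1)
  rw [covDerivOneForm_apply (g := g) hα (hs i) (e.localFrame b j),
    covDerivOneForm_apply (g := g) hα (hs j) (e.localFrame b i)]
  simp only [PseudoRiemannianMetric.covDerivOneFormAux]
  rw [htor, mvfderiv_apply_localFrame b hp (mdifferentiableAt_oneForm_apply hα (hs i)) j,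
    mvfderiv_apply_localFrame b hp (mdifferentiableAt_oneForm_apply hα (hs j)) i]
  ring

/-- **Closed `1`-forms have symmetric coordinate derivatives**: if `∇α` is symmetric at a point
`p` of the chart domain (`dα = 0` at `p`), then `∂ⱼ α̂ᵢ (φ p) = ∂ᵢ α̂ⱼ (φ p)` for the components
`α̂ₖ = α(∂ₖ) ∘ φ⁻¹`. O'Neill 1983, Ch. 3, Def. 3.17; Spivak 1965, Ch. 4 (`dω = 0` in coordinates).
[cite: ONeill1983, Ch. 3, Def. 3.17] -/
theorem fderiv_oneForm_rep_comm_of_isSymm (hp : p ∈ (chartAt H x₀).source)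
    {α : Π x : X, TangentSpace I x →L[ℝ] ℝ}
    (hα : MDifferentiableAt I (I.prod 𝓘(ℝ, E →L[ℝ] ℝ)) (oneFormSection α) p)
    (hsymm : (g.covDerivOneForm α p).IsSymm) (i j : ι) :
    fderiv ℝ ((fun q ↦ α q ((trivializationAt E (TangentSpace I) x₀).localFrame b i q)) ∘
        (extChartAt I x₀).symm) (extChartAt I x₀ p) (b j) =
      fderiv ℝ ((fun q ↦ α q ((trivializationAt E (TangentSpace I) x₀).localFrame b j q)) ∘
        (extChartAt I x₀).symm) (extChartAt I x₀ p) (b i) := by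
  have h := covDerivOneForm_localFrame_sub g b hp hα i j
  rw [hsymm.eq, sub_self] at h
  linarith

variable [T2Space X]

/-- **Closed `1`-forms are locally exact (Poincaré lemma on a manifold).** If the `1`-form `α` is
`C^∞` with symmetric covariant derivative (`dα = 0`) on an open set `U ∋ x₀`, then there is a
`C^∞` function `u : X → ℝ` (globally defined, by a bump-function cut-off) with `du = α` on a
neighbourhood of `x₀`. In the chart at `x₀` the components `α̂ₖ = α(∂ₖ) ∘ φ⁻¹` have symmetric
partial derivatives (`covDerivOneForm_localFrame_sub`), so the coordinate covector field
`∑ α̂ₖ dxᵏ` has a `C^∞` potential on a ball (`exists_contDiffOn_hasFDerivAt_of_fderiv_symm`,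
Spivak 1965, Thm. 4-11), which is pulled back by the chart and cut off.
Lee, *Introduction to Smooth Manifolds*, 2nd ed., Thm. 11.49 (closed covector fields are
locally exact); Spivak 1965, Thm. 4-11. [cite: Spivak1965, Thm. 4-11] -/
theorem exists_contMDiff_mvfderiv_eq_of_isSymm {U : Set X} (hU : IsOpen U) (hx₀ : x₀ ∈ U)
    {α : Π x : X, TangentSpace I x →L[ℝ] ℝ}
    (hα : ∀ x ∈ U, ContMDiffAt I (I.prod 𝓘(ℝ, E →L[ℝ] ℝ)) ∞ (oneFormSection α) x)
    (hsymm : ∀ x ∈ U, (g.covDerivOneForm α x).IsSymm) :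
    ∃ u : X → ℝ, ContMDiff I 𝓘(ℝ, ℝ) ∞ u ∧ ∀ᶠ q in 𝓝 x₀, mvfderiv I u q = α q := by
  classical
  -- chart data at `x₀`
  set φ := extChartAt I x₀ with hφ
  set e := trivializationAt E (TangentSpace I) x₀ with he
  set bE := Module.finBasis ℝ E with hbE
  set z₀ : E := φ x₀ with hz₀
  have hx₀s : x₀ ∈ (chartAt H x₀).source := mem_chart_source H x₀
  have hsrc : ∀ {q : X}, q ∈ (chartAt H x₀).source ↔ q ∈ φ.source := by
    intro q; rw [hφ, extChartAt_source]
  -- components of `α` in the chart and the coordinate covector field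
  set a : Fin (Module.finrank ℝ E) → E → ℝ :=
    fun k ↦ (fun q ↦ α q (e.localFrame bE k q)) ∘ φ.symm with ha
  set ℓ : Fin (Module.finrank ℝ E) → E →L[ℝ] ℝ :=
    fun k ↦ LinearMap.toContinuousLinearMap (bE.coord k) with hℓ
  have hℓ_apply : ∀ k w, ℓ k w = bE.repr w k := fun k w ↦ rfl
  set A : E → E →L[ℝ] ℝ := fun z ↦ ∑ k, a k z • ℓ k with hA
  -- the open set `W = φ.target ∩ φ⁻¹(U)` of the chart image, and a ball in it
  set W : Set E := φ.target ∩ φ.symm ⁻¹' U with hW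
  have hWo : IsOpen W :=
    (continuousOn_extChartAt_symm x₀).isOpen_inter_preimage (isOpen_extChartAt_target x₀) hU
  have hz₀W : z₀ ∈ W := ⟨mem_extChartAt_target x₀, by simp [hz₀, hφ, hx₀]⟩
  obtain ⟨r, hr, hball⟩ := Metric.isOpen_iff.1 hWo z₀ hz₀W
  -- points over the ball
  have hWsrc : ∀ {z}, z ∈ W → φ.symm z ∈ (chartAt H x₀).source := fun hz ↦ by
    rw [hsrc]; exact φ.map_target hz.1
  have hWU : ∀ {z}, z ∈ W → φ.symm z ∈ U := fun hz ↦ hz.2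
  -- (a) the components are `C^∞` on `W`
  have hF : ∀ k, ∀ q ∈ (chartAt H x₀).source, q ∈ U →
      ContMDiffAt I 𝓘(ℝ, ℝ) ∞ (fun q ↦ α q (e.localFrame bE k q)) q := by
    intro k q hq hqU
    have hqe : q ∈ e.baseSet := by simpa [he] using hq
    have hfr : ContMDiffAt I (I.prod 𝓘(ℝ, E)) ∞
        (fun p ↦ TotalSpace.mk' E p (e.localFrame bE k p)) q :=
      contMDiffAt_localFrame_of_mem ∞ e bE k hqe
    have : ContMDiffAt I (I.prod 𝓘(ℝ, ℝ)) ∞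
        (fun p ↦ TotalSpace.mk' ℝ (E := Bundle.Trivial X ℝ) p (α p (e.localFrame bE k p))) q := by
      apply ContMDiffAt.clm_bundle_apply (F₁ := E)
      · exact hα q hqU
      · exact hfr
    simp only [contMDiffAt_totalSpace] at this
    exact this.2
  have ha_smooth : ∀ k, ∀ z ∈ W, ContDiffAt ℝ ∞ (a k) z := by
    intro k z hz
    have hsy : ContMDiffAt 𝓘(ℝ, E) I ∞ φ.symm z :=
      (contMDiffOn_extChartAt_symm x₀).contMDiffAt ((isOpen_extChartAt_target x₀).mem_nhds hz.1)
    exact contMDiffAt_iff_contDiffAt.1 ((hF k _ (hWsrc hz) (hWU hz)).comp z hsy)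
  have hA_smooth : ContDiffOn ℝ ∞ A (ball z₀ r) := by
    refine ContDiffOn.sum fun k _ ↦ ?_
    have hak : ContDiffOn ℝ ∞ (a k) (ball z₀ r) := fun z hz ↦
      (ha_smooth k z (hball hz)).contDiffWithinAt
    exact hak.smul contDiffOn_const
  -- (b) the derivative of `A` and its symmetry on the ball
  have hAd : ∀ z ∈ ball z₀ r,
      HasFDerivAt A (∑ k, (fderiv ℝ (a k) z).smulRight (ℓ k)) z := by
    intro z hz
    have : HasFDerivAt (fun z ↦ ∑ k, a k z • ℓ k)
        (∑ k, (fderiv ℝ (a k) z).smulRight (ℓ k)) z :=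
      HasFDerivAt.fun_sum fun k _ ↦
        (((ha_smooth k z (hball hz)).differentiableAt (by simp)).hasFDerivAt).smul_const (ℓ k)
    exact this
  have hA_basis : ∀ z ∈ ball z₀ r, ∀ i j,
      fderiv ℝ A z (bE i) (bE j) = fderiv ℝ (a j) z (bE i) := by
    intro z hz i j
    rw [(hAd z hz).fderiv]
    simp only [FunLike.coe_sum, Finset.sum_apply,
      ContinuousLinearMap.smulRight_apply, FunLike.coe_smul, Pi.smul_apply,
      hℓ_apply, Module.Basis.repr_self, smul_eq_mul]
    simp [Finsupp.single_apply]
  have hA_symm : ∀ z ∈ ball z₀ r, ∀ v w : E, fderiv ℝ A z v w = fderiv ℝ A z w v := by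
    intro z hz
    -- symmetry on the basis, from the closedness of `α` at `φ⁻¹ z`
    have hq : φ.symm z ∈ (chartAt H x₀).source := hWsrc (hball hz)
    have hqU : φ.symm z ∈ U := hWU (hball hz)
    have hαd : MDifferentiableAt I (I.prod 𝓘(ℝ, E →L[ℝ] ℝ)) (oneFormSection α) (φ.symm z) :=
      (hα _ hqU).mdifferentiableAt (by simp)
    have hzz : φ (φ.symm z) = z := φ.right_inv (hball hz).1
    have key : ∀ i j, fderiv ℝ A z (bE i) (bE j) = fderiv ℝ A z (bE j) (bE i) := by
      intro i j
      rw [hA_basis z hz i j, hA_basis z hz j i]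
      have h := covDerivOneForm_localFrame_sub g bE hq hαd j i
      rw [(hsymm _ hqU).eq, sub_self, hzz] at h
      simp only [ha]
      linarith
    intro v w
    conv_lhs => rw [← bE.sum_repr v, ← bE.sum_repr w]
    conv_rhs => rw [← bE.sum_repr v, ← bE.sum_repr w]
    simp only [map_sum, map_smul, FunLike.coe_sum, Finset.sum_apply,
      FunLike.coe_smul, Pi.smul_apply, smul_eq_mul, Finset.mul_sum]
    rw [Finset.sum_comm]
    refine Finset.sum_congr rfl fun i _ ↦ Finset.sum_congr rfl fun j _ ↦ ?_
    rw [key i j]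
    ring
  -- (c) the Poincaré lemma in the chart
  obtain ⟨uh, huh, hduh⟩ := exists_contDiffOn_hasFDerivAt_of_fderiv_symm hA_smooth hA_symm
  -- (d) pull back: `u₀ = uh ∘ φ` has `du₀ = α` on `V = φ.source ∩ φ⁻¹(ball)`
  set V : Set X := (chartAt H x₀).source ∩ φ ⁻¹' ball z₀ r with hV
  have hVo : IsOpen V := by
    have := (continuousOn_extChartAt (I := I) x₀).isOpen_inter_preimage
      (isOpen_extChartAt_source (I := I) x₀) (isOpen_ball : IsOpen (ball z₀ r))
    rwa [extChartAt_source] at this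
  have hx₀V : x₀ ∈ V := by
    refine ⟨hx₀s, ?_⟩
    show φ x₀ ∈ ball z₀ r
    exact mem_ball_self hr
  set u₀ : X → ℝ := fun q ↦ uh (φ q) with hu₀
  have hu₀_smooth : ∀ q ∈ V, ContMDiffAt I 𝓘(ℝ, ℝ) ∞ u₀ q := by
    intro q hq
    have h1 : ContDiffAt ℝ ∞ uh (φ q) := huh.contDiffAt (isOpen_ball.mem_nhds hq.2)
    exact h1.contMDiffAt.comp q (contMDiffAt_extChartAt' hq.1)
  have hdu₀ : ∀ q ∈ V, mvfderiv I u₀ q = α q := by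
    intro q hq
    have hqe : q ∈ e.baseSet := by simpa [he] using hq.1
    have hqs : q ∈ φ.source := hsrc.1 hq.1
    have hu₀d : MDifferentiableAt I 𝓘(ℝ, ℝ) u₀ q := (hu₀_smooth q hq).mdifferentiableAt (by simp)
    -- compare on the coordinate basis of `T_q X`
    have hbasis : ∀ k, e.localFrame bE k q = e.basisAt bE hqe k := fun k ↦
      e.localFrame_apply_of_mem_baseSet bE hqe
    apply ContinuousLinearMap.coe_injective
    refine (e.basisAt bE hqe).ext fun k ↦ ?_
    simp only [ContinuousLinearMap.coe_coe, ← hbasis]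
    rw [mvfderiv_apply_localFrame bE hq.1 hu₀d k]
    -- `u₀ ∘ φ⁻¹ = uh` near `φ q`
    have heq : u₀ ∘ φ.symm =ᶠ[𝓝 (φ q)] uh := by
      filter_upwards [(isOpen_extChartAt_target x₀).mem_nhds (φ.map_source hqs)] with z hz
      simp only [hu₀, Function.comp_apply, φ.right_inv hz]
    rw [heq.fderiv_eq, (hduh _ hq.2).fderiv]
    simp only [hA, FunLike.coe_sum, Finset.sum_apply, FunLike.coe_smul,
      Pi.smul_apply, hℓ_apply, Module.Basis.repr_self, smul_eq_mul]
    simp only [Finsupp.single_apply, mul_ite, mul_one, mul_zero, Finset.sum_ite_eq,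
      Finset.mem_univ, if_true, ha, Function.comp_apply]
    rw [φ.left_inv hqs]
  -- (e) cut off with a bump function supported in `V`
  obtain ⟨f, -, hf⟩ := (SmoothBumpFunction.nhds_basis_tsupport (I := I) x₀).mem_iff.1
    (hVo.mem_nhds hx₀V)
  refine ⟨fun q ↦ f q * u₀ q, ?_, ?_⟩
  · refine contMDiff_of_tsupport fun q hq ↦ ?_
    have hqV : q ∈ V := hf (tsupport_mul_subset_left hq)
    exact f.contMDiffAt.mul (hu₀_smooth q hqV)
  · -- near `x₀`, `f = 1` on a neighbourhood, so `d(f u₀) = du₀ = α`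
    have h1 : ∀ᶠ q in 𝓝 x₀, (fun q ↦ f q * u₀ q) =ᶠ[𝓝 q] u₀ := by
      have hev : ∀ᶠ q in 𝓝 x₀, f q = 1 := f.eventuallyEq_one
      filter_upwards [eventually_eventually_nhds.2 hev] with q hq
      filter_upwards [hq] with y hy
      simp [hy]
    filter_upwards [h1, hVo.mem_nhds hx₀V] with q hq hqV
    rw [mvfderiv_congr_of_eventuallyEq hq, hdu₀ q hqV]

/-- **The Bochner formula for closed and coclosed `1`-forms** (pointwise). If the `1`-form `α` is
`C^∞`, closed (`∇α` symmetric) and coclosed (`tr_g ∇α = 0`) on an open set `U ∋ x₀` of a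
pseudo-Riemannian manifold, then at `x₀`

  `Δ_g (g⁻¹(α, α)) = 2 |∇α|²_g + 2 Ric(♯α, ♯α)`,

`Δ_g = tr_g Hess` (`dalembertian`), `|∇α|²_g = normSq (∇α)`. Proof as printed for harmonic
`1`-forms via local exactness: near `x₀`, `α = du` with `u` smooth
(`exists_contMDiff_mvfderiv_eq_of_isSymm`), so `∇α = Hess u` (`covDerivOneForm_mvfderiv`),
`Δ_g u = tr ∇α = 0` near `x₀`, and the Bochner formula for functions
`Δ|∇u|² = 2|Hess u|² + 2 g⁻¹(du, dΔu) + 2 Ric(∇u, ∇u)` (`dalembertian_gradSq_eq`, Topping 2006,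
proof of Prop. 8.2.6) loses its middle term. This is the case `k = 1` of the Bochner–Weitzenböck
formula `Δ₁ = ∇*∇ + Ric` applied to a harmonic form (Carron 1999HdR, §4.a; Carron 2007, proof
of Cor. 2.12: "`α ∈ ℋ¹` satisfies the Bochner identity `∫|∇α|² + Ric(α, α) = 0`", pointwise form).
[cite: Carron1999HdR, §4.a] -/
theorem dalembertian_innerDual_eq_of_isSymm_of_trace_eq_zero {U : Set X} (hU : IsOpen U)
    (hx₀ : x₀ ∈ U) {α : Π x : X, TangentSpace I x →L[ℝ] ℝ}
    (hα : ∀ x ∈ U, ContMDiffAt I (I.prod 𝓘(ℝ, E →L[ℝ] ℝ)) ∞ (oneFormSection α) x)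
    (hsymm : ∀ x ∈ U, (g.covDerivOneForm α x).IsSymm)
    (htr : ∀ x ∈ U, g.trace x (g.covDerivOneForm α x) = 0) :
    g.dalembertian (fun y ↦ g.innerDual y (α y).toLinearMap (α y).toLinearMap) x₀ =
      2 * g.normSq x₀ (g.covDerivOneForm α x₀) +
        2 * g.ricci x₀ (g.sharp x₀ (α x₀).toLinearMap) (g.sharp x₀ (α x₀).toLinearMap) := by
  obtain ⟨u, hu, hdu⟩ := exists_contMDiff_mvfderiv_eq_of_isSymm g hU hx₀ hα hsymm
  have hB := dalembertian_gradSq_eq g hu x₀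
  have hu2 : ∀ y, CMDiffAt 2 u y := fun y ↦
    (hu.of_le (WithTop.coe_le_coe.mpr le_top)).contMDiffAt
  -- `du = α` near `x₀`, as germs at every nearby point
  have hdu2 : ∀ᶠ q in 𝓝 x₀, ∀ᶠ y in 𝓝 q, mvfderiv I u y = α y := eventually_eventually_nhds.2 hdu
  have hU' : ∀ᶠ q in 𝓝 x₀, q ∈ U := hU.mem_nhds hx₀
  -- (i) `|∇u|² = g⁻¹(α, α)` near `x₀`
  have h1 : g.gradSq u =ᶠ[𝓝 x₀] fun y ↦ g.innerDual y (α y).toLinearMap (α y).toLinearMap := by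
    filter_upwards [hdu] with q hq
    simp only [PseudoRiemannianMetric.gradSq, hq]
  -- (ii) `Hess u = ∇α` at `x₀`
  have h2 : g.hessian u x₀ = g.covDerivOneForm α x₀ := by
    rw [← covDerivOneForm_mvfderiv (g := g) (hu2 x₀)]
    exact covDerivOneForm_congr_of_eventuallyEq hdu
  -- (iii) `Δ u = 0` near `x₀`, hence `d(Δu)(x₀) = 0`
  have h3 : g.dalembertian u =ᶠ[𝓝 x₀] fun _ ↦ (0 : ℝ) := by
    filter_upwards [hdu2, hU'] with q hq hqU
    simp only [PseudoRiemannianMetric.dalembertian]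
    rw [← covDerivOneForm_mvfderiv (g := g) (hu2 q), covDerivOneForm_congr_of_eventuallyEq hq]
    exact htr q hqU
  have h3' : mvfderiv I (g.dalembertian u) x₀ = 0 := by
    rw [mvfderiv_congr_of_eventuallyEq h3, mvfderiv_const]
  -- (iv) `du(x₀) = α(x₀)`
  have h4 : mvfderiv I u x₀ = α x₀ := hdu.self_of_nhds
  rw [g.dalembertian_congr_of_eventuallyEq h1, h2, h3', h4] at hB
  rw [hB]
  simp [PseudoRiemannianMetric.innerDual]

variable [MeasurableSpace X] [BorelSpace X] [T3Space X] in
/-- **Bochner's formula for `L²` harmonic `1`-forms**: for a Riemannian metric `h` and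
`α ∈ ℋ¹(X, h)` (smooth, `L²`, `dα = 0`, `d*α = 0`), at every point
`Δ_h |α|² = 2 |∇α|² + 2 Ric(♯α, ♯α)`. Carron 1999HdR, §4.a (Bochner–Weitzenböck for `k = 1`,
`R₁ = Ric`); Carron 2007, proof of Cor. 2.12. [cite: Carron1999HdR, §4.a] -/
theorem dalembertian_innerDual_eq_of_mem_l2HarmonicOneForms
    (h : ContMDiffRiemannianMetric I ∞ E (TangentSpace I : X → Type _))
    [(PseudoRiemannianMetric.ofRiemannian h).HasLeviCivita]
    {α : Π x : X, TangentSpace I x →L[ℝ] ℝ} (hα : α ∈ l2HarmonicOneForms h) (x : X) :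
    (PseudoRiemannianMetric.ofRiemannian h).dalembertian
        (fun y ↦ (PseudoRiemannianMetric.ofRiemannian h).innerDual y (α y).toLinearMap
          (α y).toLinearMap) x =
      2 * (PseudoRiemannianMetric.ofRiemannian h).normSq x
          ((PseudoRiemannianMetric.ofRiemannian h).covDerivOneForm α x) +
        2 * (PseudoRiemannianMetric.ofRiemannian h).ricci x
          ((PseudoRiemannianMetric.ofRiemannian h).sharp x (α x).toLinearMap)
          ((PseudoRiemannianMetric.ofRiemannian h).sharp x (α x).toLinearMap) := by
  obtain ⟨hs, -, hsy, htr⟩ := (mem_l2HarmonicOneForms_iff h).1 hα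
  exact dalembertian_innerDual_eq_of_isSymm_of_trace_eq_zero (PseudoRiemannianMetric.ofRiemannian h)
    isOpen_univ (mem_univ x) (fun y _ ↦ hs y) (fun y _ ↦ hsy y) (fun y _ ↦ htr y)

/-! ### Regularity of `|α|²`, `|∇α|²` -/

/-- **`|∇α|²` is `C^∞` for a closed `C^∞` `1`-form**: near each point `∇α = Hess u` for a smooth
local potential `u` (`exists_contMDiff_mvfderiv_eq_of_isSymm`, `covDerivOneForm_mvfderiv`), and
`|Hess u|²` is smooth (`contMDiff_normSq_hessian`). [folklore] -/
theorem contMDiffAt_normSq_covDerivOneForm {U : Set X} (hU : IsOpen U) (hx₀ : x₀ ∈ U)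
    {α : Π x : X, TangentSpace I x →L[ℝ] ℝ}
    (hα : ∀ x ∈ U, ContMDiffAt I (I.prod 𝓘(ℝ, E →L[ℝ] ℝ)) ∞ (oneFormSection α) x)
    (hsymm : ∀ x ∈ U, (g.covDerivOneForm α x).IsSymm) :
    ContMDiffAt I 𝓘(ℝ, ℝ) ∞ (fun y ↦ g.normSq y (g.covDerivOneForm α y)) x₀ := by
  obtain ⟨u, hu, hdu⟩ := exists_contMDiff_mvfderiv_eq_of_isSymm g hU hx₀ hα hsymm
  have hu2 : ∀ y, CMDiffAt 2 u y := fun y ↦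
    (hu.of_le (WithTop.coe_le_coe.mpr le_top)).contMDiffAt
  have hdu2 : ∀ᶠ q in 𝓝 x₀, ∀ᶠ y in 𝓝 q, mvfderiv I u y = α y := eventually_eventually_nhds.2 hdu
  refine ((contMDiff_normSq_hessian g hu) x₀).congr_of_eventuallyEq ?_
  filter_upwards [hdu2] with q hq
  show g.normSq q (g.covDerivOneForm α q) = g.normSq q (g.hessian u q)
  rw [← covDerivOneForm_mvfderiv (g := g) (hu2 q), covDerivOneForm_congr_of_eventuallyEq hq]

section Riemannian

variable [MeasurableSpace X] [BorelSpace X] [T3Space X]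
  (h : ContMDiffRiemannianMetric I ∞ E (TangentSpace I : X → Type _))
  [(PseudoRiemannianMetric.ofRiemannian h).HasLeviCivita]

omit [CompleteSpace E] [I.Boundaryless] [T2Space X] [MeasurableSpace X] [BorelSpace X]
  [T3Space X] in
/-- **The pointwise Caccioppoli bound** behind the energy estimate for harmonic `1`-forms: for a
`C^∞` function `χ` and a `C^∞` `1`-form `α` of a Riemannian metric `h`, at every point

  `-h⁻¹(d(χ²), d|α|²) ≤ χ² |∇α|² + 4 |dχ|² |α|²`

(`d(χ²) = 2χ dχ`, Cauchy–Schwarz for `h⁻¹`, Kato `|d|α|²|² ≤ 4|α|²|∇α|²` and `2ab ≤ a² + b²`).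
Carron 2007, proof of Cor. 2.12 / Carron 1999HdR, §4.a (Kato). [cite: Carron1999HdR, §4.a] -/
theorem neg_innerDual_mvfderiv_sq_le {x : X} {χ : X → ℝ} (hχ : ContMDiffAt I 𝓘(ℝ, ℝ) ∞ χ x)
    {α : Π x : X, TangentSpace I x →L[ℝ] ℝ}
    (hα : ContMDiffAt I (I.prod 𝓘(ℝ, E →L[ℝ] ℝ)) ∞ (oneFormSection α) x) :
    -(PseudoRiemannianMetric.ofRiemannian h).innerDual x
        (mvfderiv I (fun y ↦ χ y ^ 2) x).toLinearMap
        (mvfderiv I (fun y ↦ (PseudoRiemannianMetric.ofRiemannian h).innerDual y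
          (α y).toLinearMap (α y).toLinearMap) x).toLinearMap ≤
      χ x ^ 2 * (PseudoRiemannianMetric.ofRiemannian h).normSq x
          ((PseudoRiemannianMetric.ofRiemannian h).covDerivOneForm α x) +
        4 * (PseudoRiemannianMetric.ofRiemannian h).innerDual x (mvfderiv I χ x).toLinearMap
            (mvfderiv I χ x).toLinearMap *
          (PseudoRiemannianMetric.ofRiemannian h).innerDual x (α x).toLinearMap
            (α x).toLinearMap := by
  have hkato := kato_sq h le_rfl (by exact_mod_cast le_top) hα
  have hχd : MDifferentiableAt I 𝓘(ℝ, ℝ) χ x := hχ.mdifferentiableAt (by simp)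
  have hsq : (fun y ↦ χ y ^ 2) = χ * χ := by funext y; simp [pow_two]
  have hd2 : mvfderiv I (fun y ↦ χ y ^ 2) x = (2 * χ x) • mvfderiv I χ x := by
    rw [hsq, mvfderiv_mul hχd hχd, two_mul, add_smul]
  rw [hd2]
  set G := PseudoRiemannianMetric.ofRiemannian h with hG
  set D := mvfderiv I χ x with hD
  set M := mvfderiv I (fun y ↦ G.innerDual y (α y).toLinearMap (α y).toLinearMap) x with hM
  have hcs := innerDual_sq_le h x D.toLinearMap M.toLinearMap
  have hA : 0 ≤ G.innerDual x (α x).toLinearMap (α x).toLinearMap := innerDual_self_nonneg (h := h) x _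
  have hDn : 0 ≤ G.innerDual x D.toLinearMap D.toLinearMap := innerDual_self_nonneg (h := h) x _
  have hN : 0 ≤ G.normSq x (G.covDerivOneForm α x) :=
    G.normSq_nonneg x (PseudoRiemannianMetric.isRiemannian_ofRiemannian h) _
  have hlin : G.innerDual x ((2 * χ x) • D).toLinearMap M.toLinearMap =
      2 * χ x * G.innerDual x D.toLinearMap M.toLinearMap := by
    simp only [PseudoRiemannianMetric.innerDual, ContinuousLinearMap.toLinearMap_smul,
      LinearMap.smul_apply, smul_eq_mul]
  rw [hlin]
  -- `K² ≤ |dχ|² |dN|² ≤ |dχ|² · 4|α|² |∇α|²`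
  set K := G.innerDual x D.toLinearMap M.toLinearMap with hK
  have h1 : K ^ 2 ≤ G.innerDual x D.toLinearMap D.toLinearMap *
      (4 * G.innerDual x (α x).toLinearMap (α x).toLinearMap * G.normSq x (G.covDerivOneForm α x)) :=
    hcs.trans (mul_le_mul_of_nonneg_left hkato hDn)
  nlinarith [h1, sq_nonneg (χ x ^ 2 * G.normSq x (G.covDerivOneForm α x) -
    4 * G.innerDual x D.toLinearMap D.toLinearMap * G.innerDual x (α x).toLinearMap (α x).toLinearMap),
    sq_nonneg (χ x), mul_nonneg hDn hA, mul_nonneg (sq_nonneg (χ x)) hN,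
    sq_nonneg (2 * χ x * K + (χ x ^ 2 * G.normSq x (G.covDerivOneForm α x) +
      4 * G.innerDual x D.toLinearMap D.toLinearMap * G.innerDual x (α x).toLinearMap (α x).toLinearMap))]

end Riemannian

/-! ### The integrated Bochner identity and the energy (Caccioppoli) estimate -/

section Integrated

open _root_.MeasureTheory

variable {m : ℕ} {H' : Type*} [TopologicalSpace H']
  {J : ModelWithCorners ℝ (EuclideanSpace ℝ (Fin m)) H'} [J.Boundaryless]
  {N : Type*} [TopologicalSpace N] [ChartedSpace H' N] [IsManifold J ∞ N]
  [T3Space N] [SecondCountableTopology N] [MeasurableSpace N] [BorelSpace N]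
  (h : ContMDiffRiemannianMetric J ∞ (EuclideanSpace ℝ (Fin m)) (TangentSpace J : N → Type _))
  [(PseudoRiemannianMetric.ofRiemannian h).HasLeviCivita]

/-- **The Bochner identity of an `L²` harmonic `1`-form, integrated against a test function.**
For `α ∈ ℋ¹(N, h)` on a Riemannian manifold modelled on `ℝ^m` and `χ ∈ C^∞_c(N)`:

  `∫_N χ² (2|∇α|² + 2 Ric(♯α, ♯α)) dμ_h = -∫_N h⁻¹(d(χ²), d|α|²) dμ_h`

(Green's first identity `∫ u Δf = -∫ h⁻¹(du, df)` for `u = χ² ∈ C¹_c`, `f = |α|² ∈ C²`, and the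
pointwise Bochner formula `dalembertian_innerDual_eq_of_mem_l2HarmonicOneForms`). Carron 2007,
proof of Cor. 2.12 ("`α ∈ ℋ¹(M)` satisfies the Bochner identity"); memoir §4.a, proof of Prop. 4.1
("on peut justifier la formule d'intégration par partie `0 = ⟨α, Δα⟩ = ∫|∇α|² + ⟨R_k α, α⟩`",
here in its localised form). [cite: Carron1999HdR, §4.a, Prop. 4.1 (proof)] -/
theorem integral_sq_mul_bochner_eq_neg_integral_innerDual {α : Π x : N, TangentSpace J x →L[ℝ] ℝ}
    (hα : α ∈ l2HarmonicOneForms h) {χ : N → ℝ} (hχ : ContMDiff J 𝓘(ℝ, ℝ) ∞ χ)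
    (hχc : HasCompactSupport χ) :
    ∫ p, χ p ^ 2 * (2 * (PseudoRiemannianMetric.ofRiemannian h).normSq p
          ((PseudoRiemannianMetric.ofRiemannian h).covDerivOneForm α p) +
        2 * (PseudoRiemannianMetric.ofRiemannian h).ricci p
          ((PseudoRiemannianMetric.ofRiemannian h).sharp p (α p).toLinearMap)
          ((PseudoRiemannianMetric.ofRiemannian h).sharp p (α p).toLinearMap))
        ∂riemannianMeasure h =
      -∫ p, (PseudoRiemannianMetric.ofRiemannian h).innerDual p
          (mvfderiv J (fun y ↦ χ y ^ 2) p).toLinearMap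
          (mvfderiv J (fun y ↦ (PseudoRiemannianMetric.ofRiemannian h).innerDual y
            (α y).toLinearMap (α y).toLinearMap) p).toLinearMap ∂riemannianMeasure h := by
  haveI : LocallyCompactSpace N := Manifold.locallyCompact_of_finiteDimensional J
  have hs := ((mem_l2HarmonicOneForms_iff h).1 hα).1
  -- `|α|²` is `C^∞`, `χ²` is `C¹` with compact support
  have hN : ContMDiff J 𝓘(ℝ, ℝ) ∞ (fun y ↦ (PseudoRiemannianMetric.ofRiemannian h).innerDual y
      (α y).toLinearMap (α y).toLinearMap) := fun y ↦
    contMDiffAt_innerDual_oneForm (PseudoRiemannianMetric.ofRiemannian h) (hs y) (hs y)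
  have hN2 : CMDiff 2 (fun y ↦ (PseudoRiemannianMetric.ofRiemannian h).innerDual y
      (α y).toLinearMap (α y).toLinearMap) := hN.of_le (WithTop.coe_le_coe.mpr le_top)
  have hχ2 : CMDiff 1 (fun y ↦ χ y ^ 2) := (hχ.pow 2).of_le (by exact_mod_cast le_top)
  have hχ2c : HasCompactSupport (fun y ↦ χ y ^ 2) := by
    have : (fun y ↦ χ y ^ 2) = χ * χ := by funext y; simp [pow_two]
    rw [this]; exact hχc.mul_left
  rw [← integral_mul_dalembertian_eq_neg_integral_innerDual_of_hasCompactSupport h hχ2 hχ2c hN2]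
  refine integral_congr_ae (ae_of_all _ fun p ↦ ?_)
  simp only
  rw [dalembertian_innerDual_eq_of_mem_l2HarmonicOneForms h hα p]

/-- **The energy (Caccioppoli) estimate for `L²` harmonic `1`-forms.** For `α ∈ ℋ¹(N, h)` on a
Riemannian manifold modelled on `ℝ^m` and every `χ ∈ C^∞_c(N)`:

  `∫_N χ² |∇α|² dμ_h ≤ 4 ∫_N |dχ|² |α|² dμ_h - 2 ∫_N χ² Ric(♯α, ♯α) dμ_h`

(the integrated Bochner identity `integral_sq_mul_bochner_eq_neg_integral_innerDual` and the
pointwise Kato–Cauchy–Schwarz bound `neg_innerDual_mvfderiv_sq_le`). With cut-offs `χ_R` of a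
complete manifold (`|dχ_R| ≤ 1/R`) this is how `∇α ∈ L²` and `∫|∇α|² + Ric(♯α,♯α) ≤ 0` are
obtained in the proof of Carron's theorem (memoir §4.a–b; Carron 2007, proof of Cor. 2.12).
[cite: Carron1999HdR, §4.a, Prop. 4.1 (proof)] -/
theorem integral_sq_mul_normSq_covDerivOneForm_le {α : Π x : N, TangentSpace J x →L[ℝ] ℝ}
    (hα : α ∈ l2HarmonicOneForms h) {χ : N → ℝ} (hχ : ContMDiff J 𝓘(ℝ, ℝ) ∞ χ)
    (hχc : HasCompactSupport χ) :
    ∫ p, χ p ^ 2 * (PseudoRiemannianMetric.ofRiemannian h).normSq p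
        ((PseudoRiemannianMetric.ofRiemannian h).covDerivOneForm α p) ∂riemannianMeasure h ≤
      4 * ∫ p, (PseudoRiemannianMetric.ofRiemannian h).innerDual p (mvfderiv J χ p).toLinearMap
            (mvfderiv J χ p).toLinearMap *
          (PseudoRiemannianMetric.ofRiemannian h).innerDual p (α p).toLinearMap (α p).toLinearMap
          ∂riemannianMeasure h -
        2 * ∫ p, χ p ^ 2 * (PseudoRiemannianMetric.ofRiemannian h).ricci p
            ((PseudoRiemannianMetric.ofRiemannian h).sharp p (α p).toLinearMap)
            ((PseudoRiemannianMetric.ofRiemannian h).sharp p (α p).toLinearMap)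
          ∂riemannianMeasure h := by
  haveI : LocallyCompactSpace N := Manifold.locallyCompact_of_finiteDimensional J
  set G := PseudoRiemannianMetric.ofRiemannian h with hG
  obtain ⟨hs, -, hsy, htr⟩ := (mem_l2HarmonicOneForms_iff h).1 hα
  -- the four integrands
  set Nα : N → ℝ := fun y ↦ G.innerDual y (α y).toLinearMap (α y).toLinearMap with hNα
  set Q : N → ℝ := fun p ↦ G.normSq p (G.covDerivOneForm α p) with hQ
  set Rc : N → ℝ := fun p ↦ G.ricci p (G.sharp p (α p).toLinearMap) (G.sharp p (α p).toLinearMap)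
    with hRc
  set Dχ : N → ℝ := fun p ↦ G.innerDual p (mvfderiv J χ p).toLinearMap (mvfderiv J χ p).toLinearMap
    with hDχ
  set B : N → ℝ := fun p ↦ G.innerDual p (mvfderiv J (fun y ↦ χ y ^ 2) p).toLinearMap
    (mvfderiv J Nα p).toLinearMap with hB
  -- regularity
  have hN : ContMDiff J 𝓘(ℝ, ℝ) ∞ Nα := fun y ↦ contMDiffAt_innerDual_oneForm G (hs y) (hs y)
  have hN2 : CMDiff 2 Nα := hN.of_le (WithTop.coe_le_coe.mpr le_top)
  have hN1 : CMDiff 1 Nα := hN.of_le (by exact_mod_cast le_top)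
  have hQs : ContMDiff J 𝓘(ℝ, ℝ) ∞ Q := fun y ↦
    contMDiffAt_normSq_covDerivOneForm G isOpen_univ (mem_univ y) (fun z _ ↦ hs z) (fun z _ ↦ hsy z)
  have hχ1 : CMDiff 1 χ := hχ.of_le (by exact_mod_cast le_top)
  have hχ2 : CMDiff 1 (fun y ↦ χ y ^ 2) := (hχ.pow 2).of_le (by exact_mod_cast le_top)
  have hBochner : ∀ p, G.dalembertian Nα p = 2 * Q p + 2 * Rc p := fun p ↦
    dalembertian_innerDual_eq_of_mem_l2HarmonicOneForms h hα p
  have hRc_eq : Rc = fun p ↦ (G.dalembertian Nα p - 2 * Q p) / 2 := by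
    funext p; rw [hBochner p]; ring
  have hQc : Continuous Q := hQs.continuous
  have hRcc : Continuous Rc := by
    rw [hRc_eq]
    exact ((continuous_dalembertian G hN2).sub (continuous_const.mul hQc)).div_const _
  have hDχc : Continuous Dχ := continuous_innerDual_mvfderiv G hχ1 hχ1
  have hBc : Continuous B := continuous_innerDual_mvfderiv G hχ2 hN1
  have hNc : Continuous Nα := hN.continuous
  have hχc' : Continuous χ := hχ.continuous
  -- supports: everything carries a factor vanishing off `tsupport χ`
  have hK : IsCompact (tsupport χ) := hχc
  have hzero : ∀ p ∉ tsupport χ, χ p = 0 := fun p hp ↦ image_eq_zero_of_notMem_tsupport hp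
  have hdχ0 : ∀ p ∉ tsupport χ, mvfderiv J χ p = 0 := fun p hp ↦ by
    exact PseudoRiemannianMetric.mvfderiv_eq_zero_of_eventuallyEq_zero
      (notMem_tsupport_iff_eventuallyEq.1 hp)
  have hdχ20 : ∀ p ∉ tsupport χ, mvfderiv J (fun y ↦ χ y ^ 2) p = 0 := fun p hp ↦ by
    refine PseudoRiemannianMetric.mvfderiv_eq_zero_of_eventuallyEq_zero ?_
    filter_upwards [notMem_tsupport_iff_eventuallyEq.1 hp] with y hy
    simp [hy]
  have hI1 : Integrable (fun p ↦ χ p ^ 2 * Q p) (riemannianMeasure h) :=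
    integrable_of_continuous_of_hasCompactSupport h ((hχc'.pow 2).mul hQc)
      (HasCompactSupport.intro hK fun p hp ↦ by simp [hzero p hp])
  have hI2 : Integrable (fun p ↦ χ p ^ 2 * Rc p) (riemannianMeasure h) :=
    integrable_of_continuous_of_hasCompactSupport h ((hχc'.pow 2).mul hRcc)
      (HasCompactSupport.intro hK fun p hp ↦ by simp [hzero p hp])
  have hI3 : Integrable (fun p ↦ Dχ p * Nα p) (riemannianMeasure h) :=
    integrable_of_continuous_of_hasCompactSupport h (hDχc.mul hNc)
      (HasCompactSupport.intro hK fun p hp ↦ by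
        simp [hDχ, hdχ0 p hp, PseudoRiemannianMetric.innerDual])
  have hI4 : Integrable B (riemannianMeasure h) :=
    integrable_of_continuous_of_hasCompactSupport h hBc
      (HasCompactSupport.intro hK fun p hp ↦ by
        simp [hB, hdχ20 p hp, PseudoRiemannianMetric.innerDual])
  -- the integrated Bochner identity, split
  have hid := integral_sq_mul_bochner_eq_neg_integral_innerDual h hα hχ hχc
  have hsplit : ∫ p, χ p ^ 2 * (2 * Q p + 2 * Rc p) ∂riemannianMeasure h =
      2 * ∫ p, χ p ^ 2 * Q p ∂riemannianMeasure h + 2 * ∫ p, χ p ^ 2 * Rc p ∂riemannianMeasure h := by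
    have : (fun p ↦ χ p ^ 2 * (2 * Q p + 2 * Rc p)) =
        fun p ↦ 2 * (χ p ^ 2 * Q p) + 2 * (χ p ^ 2 * Rc p) := by funext p; ring
    rw [this, integral_add (hI1.const_mul 2) (hI2.const_mul 2), integral_const_mul,
      integral_const_mul]
  -- the pointwise bound, integrated
  have hpt : ∀ p, -B p ≤ χ p ^ 2 * Q p + 4 * (Dχ p * Nα p) := fun p ↦ by
    have := neg_innerDual_mvfderiv_sq_le h (hχ p) (hs p)
    simp only [hB, hQ, hDχ, hNα] at this ⊢
    linarith
  have hmono : ∫ p, -B p ∂riemannianMeasure h ≤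
      ∫ p, (χ p ^ 2 * Q p + 4 * (Dχ p * Nα p)) ∂riemannianMeasure h :=
    integral_mono hI4.neg (hI1.add (hI3.const_mul 4)) hpt
  rw [integral_neg, integral_add hI1 (hI3.const_mul 4), integral_const_mul] at hmono
  have hid' : ∫ p, χ p ^ 2 * (2 * Q p + 2 * Rc p) ∂riemannianMeasure h =
      -∫ p, B p ∂riemannianMeasure h := hid
  rw [hsplit] at hid'
  simp only [hQ, hRc, hDχ, hNα] at hid' hmono ⊢
  linarith

end Integrated

end Literature.Geometry.Riemannian

end
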